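import Summits.QuantumFields.YangMills.Theorems.UnitScaleTiltHistoryTailDiluteExponent
import Summits.QuantumFields.YangMills.Theorems.UnitScaleTiltHistoryTailIntHistoriesRows
import HarnessLib

/-!
# Route `UnitScaleTilt` — crux `HistoryTailL` (stmt-QuantumFields-19936), R-57χ successor line: STUB 4c (the dilute exponent bound) AT THE INTERIOR DATUM OF A FAMILY OF
# DATA CORES, parametric in the small-factor constant `c ∈ (0, ¼]`, (71) read on any region with base points in `Δ′(p′)` — `HistoryTailDiluteExponentCV3.diluteExponent_of_smallFactorIn`
# (fleet lead `ym-ust-18916-p1` g5) VERBATIM with `h.dataT3v3 hc γ hγ hγ1 π ↦ AlphaInputsT3AC.dataIntRows qf π`, `qf : ∀ K, PkgCoreRows …` (seat ym3-torus-p2 g16; `--supports` 19936)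

v4 NOTE (2026-08-28, seat ym-ust-19936-w4 g4): this module is the ADDITIVE F-2b TWIN over ★alpha-1∕alpha-2's row-stable core `AlphaInputsT3AC.PkgCoreRows`
(`AlphaInputsT3ACv4CoreRows`, ★★OWNER RULING g26-№14 (F-2); ★alpha-2 g7 checklist 2026-08-28T08:14:03Z (s1)–(s7)) of the v3 module of the same name without the
`Rows` suffix: binder type `PkgCoreV3 ↦ PkgCoreRows`, `dataIntV3 ↦ dataIntRows`, namespace `+Rows`, imports re-pointed to the `Rows` twins; statement and proof otherwise
byte-identical.  The v3 module stays in the tree unchanged.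

Given (b_c) and the `Zterm` clause at `κZ`, for `γ ≤ γc`, every admissible pair `(h, W)` at level `j ≤ K` and every `ccol·x_j^{r₀}`-separated family `S` of
`θBal(K−j)`-large plaquettes of the datum: `|S|·c·p(g_j)² + Σ_{i<j} #P_i(h)·(c·b₀²/50)·x_i^{2p₀−1}·(x_i − x_j) ≤ mainT_j(h,W) − Zterm_j(h)`.  The rows read are (41)-side only
(`dataIntRows_constraint42Top`, `dataIntRows_regularity68Levels`, `lfDataIntRows_largeP_of_admissible`; the collar reach `HistoryTailLaneTowerReach`), so the proof is the CV3 one over the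
core.  Nothing of [Balaban1985UV3] is asserted; CONDITIONAL only on the family `qf` (data carrying its rows). [cite: Balaban1985UV3, (5) p.256, (41)-(42) p.266, (67)-(71) p.273]
-/

noncomputable section
open scoped BigOperators

namespace Summit.QuantumFields.YangMills.Theorems.HistoryTailDiluteExponentIntRows

open MeasureTheory Literature.MathematicalPhysics.QuantumFieldTheory.Balaban1983to89 T3ContinuumYM3Torus T3UnitScaleTilt T3UnitLawDensityEML
open T3AlphaInputsAC T3AlphaInputsACSchemas
open B10LargeField (xlog)
open B10Eq38TorusDomains (toFine cornerSet plaqsIn mem_plaqsIn_iff)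
open Summit.QuantumFields.Balaban3D.Carriers Summit.QuantumFields.Balaban3D.Proofs.Primitives Summit.QuantumFields.YangMills.Theorems
open Summit.QuantumFields.YangMills.Theorems.HistoryTailTowerReach (xlog_coupling_eq one_le_xlog_coupling)
open Summit.QuantumFields.YangMills.Theorems.HistoryTailDiluteLemmas (tdist_le_of_offsets rcolOf_le natCnt_le)
open Summit.QuantumFields.YangMills.Theorems.HistoryTailDiluteBudget (budget_ineq)
open Summit.QuantumFields.YangMills.Theorems.HistoryTailDiluteCore (dilute_core)
open Classical

set_option maxHeartbeats 1600000 in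
/-- **4c AT THE INTERIOR DATUM OF A FAMILY OF DATA CORES, PARAMETRIC IN `c ∈ (0, ¼]`, (71) ON ANY REGION IN `Δ′`, NO `LargePSpec`**: given (b_c) and the `Zterm` clause at `κZ`, for
`γ ≤ γc`, every admissible pair `(h, W)` at level `j ≤ K` and every `ccol·x_j^{r₀}`-separated family `S` of `θBal(K−j)`-large plaquettes of the datum:
`|S|·c·p(g_j)² + Σ_{i<j} #P_i(h)·(c·b₀²/50)·x_i^{2p₀−1}·(x_i − x_j) ≤ mainT_j(h,W) − Zterm_j(h)`. [cite: Balaban1985UV3, (5) p.256, (41) p.266 and (69)-(71) p.273] -/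
theorem diluteExponent_of_smallFactorIn :
    ∀ (L : ℕ), Odd L → 1 < L →
      ∀ (𝔠 : AlphaConsts L (suGroupModel 2).N),
        ∀ (cSF : ℝ), 0 < cSF → cSF ≤ 1 / 4 →
        ∀ (κZ : ℝ), 0 ≤ κZ → ∃ (ccol γc : ℝ), 1 ≤ ccol ∧ 0 < γc ∧
          ∀ (F : T3Family) (hF : F.L = L) (γ : ℝ) (hγ : 0 < γ) (hγ1 : γ ≤ (min (hF ▸ 𝔠).gamma0 1) ^ 2)
            (qf : ∀ K, AlphaInputsT3AC.PkgCoreRows F (hF ▸ 𝔠) γ hγ hγ1 K) (π : AlphaInputsT3AC.PolymerT3 F), γ ≤ γc →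
            (∀ (K j : ℕ) (r : (AlphaInputsT3AC.lfDataIntRows qf π).Reg K j) (v : (i : Fin j) → GaugeField (F.P K) i (Matrix.specialUnitaryGroup (Fin 2) ℂ))
              (Wf : GaugeField (F.P K) j (Matrix.specialUnitaryGroup (Fin 2) ℂ)), j ≤ K →
              (AlphaInputsT3AC.dataIntRows qf π).Adm K j ((AlphaInputsT3AC.lfDataIntRows qf π).assemble K j r v) Wf →
              ∀ (i : ℕ) (p' : Plaq (F.P K) i), p' ∈ (AlphaInputsT3AC.lfDataIntRows qf π).LargeP K j r i →
                ∃ R₀ : Finset (Plaq (F.P K) 0), (∀ q ∈ R₀, q.src ∈ plaqCover p') ∧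
                  cSF * B10.pFun (hF ▸ 𝔠).b₀ (hF ▸ 𝔠).p₀ (Real.sqrt (γ * ((F.L : ℝ)⁻¹) ^ (K - i))) ^ 2 ≤
                    (F.scheme ℰp γ).β K *
                      ∑ q ∈ R₀, (1 - reTr (GaugeField.plaqHol
                        ((AlphaInputsT3AC.dataIntRows qf π).Umin K j ((AlphaInputsT3AC.lfDataIntRows qf π).assemble K j r v) Wf) q))) →
            (∀ (K j : ℕ) (r : (AlphaInputsT3AC.lfDataIntRows qf π).Reg K j) (v : (i : Fin j) → GaugeField (F.P K) i (Matrix.specialUnitaryGroup (Fin 2) ℂ)),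
              j ≤ K →
                0 ≤ (AlphaInputsT3AC.dataIntRows qf π).Zterm K j ((AlphaInputsT3AC.lfDataIntRows qf π).assemble K j r v) ∧
                (AlphaInputsT3AC.dataIntRows qf π).Zterm K j ((AlphaInputsT3AC.lfDataIntRows qf π).assemble K j r v) ≤
                  κZ * ∑ i ∈ Finset.range j,
                    (1 + Real.log (Real.sqrt (γ * ((F.L : ℝ)⁻¹) ^ (K - i)))⁻¹) *
                      (({y : Site (F.P K) i | toFine i y ∉ (AlphaInputsT3AC.dataIntRows qf π).Ω K j
                          ((AlphaInputsT3AC.lfDataIntRows qf π).assemble K j r v) (i + 1)} : Set (Site (F.P K) i)).ncard : ℝ)) →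
            ∀ (K j : ℕ), j ≤ K →
              ∀ (r : (AlphaInputsT3AC.lfDataIntRows qf π).Reg K j) (v : (i : Fin j) → GaugeField (F.P K) i (Matrix.specialUnitaryGroup (Fin 2) ℂ))
                (Wf : GaugeField (F.P K) j (Matrix.specialUnitaryGroup (Fin 2) ℂ)),
                (AlphaInputsT3AC.dataIntRows qf π).Adm K j ((AlphaInputsT3AC.lfDataIntRows qf π).assemble K j r v) Wf →
                ∀ S : Finset (Plaq (F.P K) j),
                  (∀ q ∈ S, θBal F.L γ (hF ▸ 𝔠).b₀ (hF ▸ 𝔠).p₀ (K - j) ≤ GaugeGroup.dist1 (GaugeField.plaqHol Wf q)) →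
                  (∀ q ∈ S, ∀ q' ∈ S, q ≠ q' →
                    ccol * (1 + Real.log (Real.sqrt (γ * ((F.L : ℝ)⁻¹) ^ (K - j)))⁻¹) ^ (hF ▸ 𝔠).r₀ ≤ (Site.tdist q.src q'.src : ℝ)) →
                  (S.card : ℝ) * (cSF * B10.pFun (hF ▸ 𝔠).b₀ (hF ▸ 𝔠).p₀ (Real.sqrt (γ * ((F.L : ℝ)⁻¹) ^ (K - j))) ^ 2) +
                      ∑ i ∈ Finset.range j, (((AlphaInputsT3AC.lfDataIntRows qf π).LargeP K j r i).card : ℝ) *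
                        (cSF * (hF ▸ 𝔠).b₀ ^ 2 / 50 *
                          (1 + Real.log (Real.sqrt (γ * ((F.L : ℝ)⁻¹) ^ (K - i)))⁻¹) ^ (2 * (hF ▸ 𝔠).p₀ - 1) *
                          ((1 + Real.log (Real.sqrt (γ * ((F.L : ℝ)⁻¹) ^ (K - i)))⁻¹) -
                            (1 + Real.log (Real.sqrt (γ * ((F.L : ℝ)⁻¹) ^ (K - j)))⁻¹))) ≤
                    (AlphaInputsT3AC.dataIntRows qf π).mainT K j ((AlphaInputsT3AC.lfDataIntRows qf π).assemble K j r v) Wf -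
                      (AlphaInputsT3AC.dataIntRows qf π).Zterm K j ((AlphaInputsT3AC.lfDataIntRows qf π).assemble K j r v) := by
  intro L hLo hL1 𝔠 cSF hcSF0 hcSF4 κZ hκZ
  -- the rescaled profile constant `b₀′ = 2√c·b₀` (`b₀′² = 4c·b₀²`)
  set b₀' : ℝ := 2 * Real.sqrt cSF * 𝔠.b₀ with hb₀'
  have hsc : Real.sqrt cSF ^ 2 = cSF := Real.sq_sqrt hcSF0.le
  have hb₀'pos : 0 < b₀' := by rw [hb₀']; have := 𝔠.b₀_pos; have := Real.sqrt_pos.mpr hcSF0; positivity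
  -- L-level constants
  let F₀ : T3Family := ⟨L, ⟨hLo, hL1⟩, 1, le_rfl⟩
  obtain ⟨γq, hγq, hγq1, hreg⟩ := HistoryTailAlphaTopQuarter.exists_gamma_quarter_regime F₀ 𝔠.b₀_pos 𝔠.p₀_pos 𝔠.C68_pos.le
  set lg : ℝ := Real.log (Real.sqrt (L : ℝ)) with hlg
  have hLr : (1 : ℝ) < (L : ℝ) := by exact_mod_cast hL1
  have hlg0 : 0 < lg := by
    rw [hlg]; refine Real.log_pos ?_; rw [show (1 : ℝ) = Real.sqrt 1 from Real.sqrt_one.symm]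
    exact Real.sqrt_lt_sqrt zero_le_one (by linarith)
  have hr1 : 1 ≤ 𝔠.r₀ := 𝔠.one_le_r₀; have hr0 : 0 ≤ 𝔠.r₀ := zero_le_one.trans hr1
  have hR0 : 0 ≤ 𝔠.R₁ := 𝔠.R₁_nonneg; have hM0 : (0 : ℝ) ≤ (𝔠.M₁ : ℝ) := Nat.cast_nonneg _
  set n₀ : ℝ := max 1 𝔠.r₀ with hn₀
  have hn0 : 0 ≤ n₀ ^ 𝔠.r₀ := Real.rpow_nonneg (zero_le_one.trans (le_max_left _ _)) _
  set cw : ℝ := 𝔠.R₁ * n₀ ^ 𝔠.r₀ * 𝔠.M₁ + 𝔠.M₁ + 3 + 3 * 𝔠.M₁ * L with hcw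
  have hcw0 : 0 ≤ cw := by rw [hcw]; positivity
  set cR : ℝ := 3 * (𝔠.R₁ * n₀ ^ 𝔠.r₀ * 𝔠.M₁ * (1 + lg) ^ 𝔠.r₀ + 𝔠.M₁ + 3 + 3 * 𝔠.M₁ * L) with hcR
  have hlg1 : 0 ≤ (1 + lg) ^ 𝔠.r₀ := Real.rpow_nonneg (by linarith) _
  have hcR0 : 0 ≤ cR := by rw [hcR]; positivity
  set c₁ : ℝ := 3 * cw + 6 with hc₁
  set A : ℝ := (4 * 3 * (c₁ + 1) + 1) ^ 3 with hA
  have hA0 : 0 ≤ A := by rw [hA]; positivity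
  set X₀ : ℝ := max 1 (515 * κZ * A / (b₀' ^ 2 * lg)) with hX₀
  set γc : ℝ := min γq (min 1 (Real.exp (-(2 * (X₀ - 1))))) with hγc
  set ccol : ℝ := 2 * cR + 569 with hccol
  refine ⟨ccol, γc, by rw [hccol]; linarith, by rw [hγc]; positivity, ?_⟩
  intro F hF γ hγ hγ1 qf π hγc' hSF hZ K j hjK r v Wf hadm S hlarge hsep
  subst hF
  have hγ1' : γ ≤ 1 := hγc'.trans ((min_le_right _ _).trans (min_le_left _ _)); have hγq' : γ ≤ γq := hγc'.trans (min_le_left _ _)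
  have hγe : γ ≤ Real.exp (-(2 * (X₀ - 1))) := hγc'.trans ((min_le_right _ _).trans (min_le_right _ _))
  set Mc : ℕ := 𝔠.lane.carrier.M₁ with hMc
  set Rc : ℕ → ℕ := rcolOf (T3Scales F γ hγ (hγ1.trans (sq_min_one_le _ 𝔠.gamma0_pos)) K) 𝔠.lane.carrier with hRc
  have hMc' : Mc = 𝔠.M₁ := rfl
  have hMpos : 0 < Mc := by rw [hMc']; exact 𝔠.M₁_pos
  have hjm : j ≤ (F.P K).m + (F.P K).K := by show j ≤ F.m + K; omega
  have hL2 : 2 ≤ (F.P K).L := by show 2 ≤ F.L; omega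
  have hd3 : (F.P K).d = 3 := rfl
  have hPL : ((F.P K).L : ℝ) = (F.L : ℝ) := rfl
  have hFL1 : (1 : ℝ) ≤ (F.L : ℝ) := by exact_mod_cast F.hL.2.le
  -- the admissible history
  have hr : Hist.Admissible Mc Rc j r := hadm.1
  -- the running quantities
  set xf : ℕ → ℝ := fun i => xlog (Real.sqrt (γ * ((F.L : ℝ)⁻¹) ^ (K - i))) with hxf
  have hxf_eq : ∀ i, 1 + Real.log (Real.sqrt (γ * ((F.L : ℝ)⁻¹) ^ (K - i)))⁻¹ = xf i := fun i => rfl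
  have hx1 : ∀ i, 1 ≤ xf i := fun i => one_le_xlog_coupling hγ hγ1' hFL1 (K - i)
  have hxmono : ∀ i l, i ≤ l → l ≤ K → xf i = xf l + (l - i : ℕ) * lg := by
    intro i l hil hlK
    have := xlog_coupling_eq hγ (by linarith : (0 : ℝ) < F.L) hil hlK (K := K)
    rw [hxf]; simp only []; rw [this, hlg]
  set X : ℝ := xf j ^ 𝔠.r₀ with hX
  have hX1 : 1 ≤ X := Real.one_le_rpow (hx1 j) hr0
  -- the collars along the flow
  have hRcol : ∀ l, l ≤ K → (Rc l : ℝ) ≤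
      (𝔠.R₁ * xlog (Real.sqrt (γ * (((F.P K).L : ℝ)⁻¹) ^ (K - l))) ^ 𝔠.r₀ + 1) * Mc := fun l hl =>
    rcolOf_le F γ hγ (hγ1.trans (sq_min_one_le _ 𝔠.gamma0_pos)) K 𝔠.lane.carrier hR0 l hl
  -- the plaquette terms and the main term
  set β : ℝ := (F.scheme ℰp γ).β K with hβ
  have hβ0 : 0 ≤ β := F.scheme_β_nonneg ℰp hγ.le K
  set T : Plaq (F.P K) 0 → ℝ := fun q => 1 - reTr (GaugeField.plaqHol ((AlphaInputsT3AC.dataIntRows qf π).Umin K j r Wf) q) with hT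
  have hT0 : ∀ q, 0 ≤ T q := fun q => by have := GaugeGroup.reTr_le_one (GaugeField.plaqHol ((AlphaInputsT3AC.dataIntRows qf π).Umin K j r Wf) q); rw [hT]; linarith
  have hmain : β * ∑ q, T q ≤ (AlphaInputsT3AC.dataIntRows qf π).mainT K j r Wf :=
    localised_le_mainT (AlphaInputsT3AC.dataIntRows_mainTermIsAction qf π) (fun K => F.scheme_β_nonneg ℰp hγ.le K) r Wf Finset.univ
  -- the regions charged by the history's plaquettes: all fine plaquettes with base point in `Δ′(c)`
  set Bl : (i : ℕ) → Plaq (F.P K) i → Finset (Plaq (F.P K) 0) := fun i c =>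
    Finset.univ.filter fun q : Plaq (F.P K) 0 => q.src ∈ plaqCover c with hBl
  have hBlcov : ∀ i (c : Plaq (F.P K) i) q, q ∈ Bl i c → q.src ∈ plaqCover c := by
    intro i c q hq; rw [hBl] at hq; exact (Finset.mem_filter.mp hq).2
  -- the RESCALED p-function `p_i = 2√c·p(g_i)` (`p_i²/4 = c·p(g_i)²`)
  set p : ℕ → ℝ := fun i => 2 * Real.sqrt cSF * B10.pFun 𝔠.b₀ 𝔠.p₀ (Real.sqrt (γ * ((F.L : ℝ)⁻¹) ^ (K - i))) with hp
  have hp_eq : ∀ i, p i = b₀' * xf i ^ (2 * 𝔠.r₀ + 1) := by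
    intro i; rw [hp, hxf, hb₀']; simp only [B10.pFun, xlog]; rw [show 𝔠.p₀ = 2 * 𝔠.r₀ + 1 from rfl]; ring
  have hp_sq : ∀ i, p i ^ 2 / 4 = cSF * B10.pFun 𝔠.b₀ 𝔠.p₀ (Real.sqrt (γ * ((F.L : ℝ)⁻¹) ^ (K - i))) ^ 2 := by
    intro i; rw [hp]; simp only []; rw [mul_pow, mul_pow, hsc]; ring
  -- localised small factors of the history's plaquettes (hypothesis (b_c), summed over the larger region `Bl i c ⊇ R₀`)
  have hSFcore : ∀ i (hi : i < j), ∀ c ∈ r ⟨i, hi⟩, p i ^ 2 / 4 ≤ β * ∑ q ∈ Bl i c, T q := by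
    intro i hi c hcm
    have hcL : c ∈ (AlphaInputsT3AC.lfDataIntRows qf π).LargeP K j r i := by
      rw [AlphaInputsT3AC.lfDataIntRows_largeP_of_admissible qf π K j r hr i hi]; exact hcm
    obtain ⟨R₀, hR₀cov, hR₀⟩ := hSF K j r v Wf hjK hadm i c hcL
    have hsub : R₀ ⊆ Bl i c := fun q hq => by rw [hBl]; exact Finset.mem_filter.mpr ⟨Finset.mem_univ _, hR₀cov q hq⟩
    rw [hp_sq i]
    exact le_trans hR₀ (mul_le_mul_of_nonneg_left (Finset.sum_le_sum_of_subset_of_nonneg hsub fun q _ _ => hT0 q) hβ0)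
  -- deep members and their boxes
  set box8 : Plaq (F.P K) j → Set (Site (F.P K) 0) := fun q =>
    {x | ∀ ι, ∃ e : ℤ, |e| ≤ 8 * ((F.P K).L : ℤ) ^ j ∧ x ι = toFine j q.src ι + (e : ZMod ((F.P K).sitesPerDir 0))} with hbox8
  set Sd : Finset (Plaq (F.P K) j) := S.filter fun q => box8 q ⊆ Omega Mc Rc j r j with hSd
  have hθ := hreg γ hγ hγq' K j
  have hdeep : ∀ q ∈ Sd, ∃ R₀ : Finset (Plaq (F.P K) 0),
      (∀ q' ∈ R₀, ∀ ι, ∃ e : ℤ, |e| ≤ 3 * (((F.P K).L : ℤ) ^ j - 1) ∧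
        q'.src ι = toFine j q.src ι + (e : ZMod ((F.P K).sitesPerDir 0))) ∧
      (1 / 4 : ℝ) * B10.pFun 𝔠.b₀ 𝔠.p₀ (Real.sqrt (γ * ((F.L : ℝ)⁻¹) ^ (K - j))) ^ 2 ≤
        β * ∑ q' ∈ R₀, (1 - reTr (GaugeField.plaqHol ((AlphaInputsT3AC.dataIntRows qf π).Umin K j r Wf) q')) := by
    intro q hq
    obtain ⟨hqS, hqΩ⟩ := Finset.mem_filter.mp hq
    exact HistoryTailAlphaTopQuarter.quarter_pFun_sq_le_localAction hγ hγ1' 𝔠.b₀_pos.le 𝔠.p₀ 𝔠.C68_pos.le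
      (AlphaInputsT3AC.dataIntRows_constraint42Top qf π) (AlphaInputsT3AC.dataIntRows_regularity68Levels qf π) hjK r Wf hadm q hqΩ (hlarge q hqS) hθ.1 hθ.2
  choose! Box hfoot hBoxSF using hdeep
  have hLj1 : (1 : ℤ) ≤ ((F.P K).L : ℤ) ^ j := one_le_pow₀ (by exact_mod_cast (F.P K).hL.2.le)
  have hBoxΩ : ∀ q ∈ Sd, ∀ q' ∈ Box q, q'.src ∈ Omega Mc Rc j r j := by
    intro q hq q' hq'
    refine (Finset.mem_filter.mp hq).2 fun ι => ?_
    obtain ⟨e, he, hx⟩ := hfoot q hq q' hq' ι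
    exact ⟨e, by linarith [hLj1], hx⟩
  have hBoxNear : ∀ q ∈ Sd, ∀ q' ∈ Box q, (Site.tdist q'.src (toFine j q.src) : ℝ) ≤ 9 * ((F.P K).L : ℝ) ^ j := by
    intro q hq q' hq'
    have h1 := tdist_le_of_offsets (ρ := 3 * (((F.P K).L : ℤ) ^ j - 1)) (hfoot q hq q' hq')
    rw [hd3] at h1; push_cast at h1
    linarith [show (1 : ℝ) ≤ ((F.P K).L : ℝ) ^ j from one_le_pow₀ (by exact_mod_cast (F.P K).hL.2.le)]
  have hBoxSF' : ∀ q ∈ Sd, p j ^ 2 / 4 ≤ β * ∑ q' ∈ Box q, T q' := by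
    intro q hq
    rw [hp_sq j]
    exact le_trans (mul_le_mul_of_nonneg_right hcSF4 (sq_nonneg _)) (hBoxSF q hq)
  have hNonDeep : ∀ q ∈ S, q ∉ Sd → ∃ z, z ∉ Omega Mc Rc j r j ∧ (Site.tdist z (toFine j q.src) : ℝ) ≤ 24 * ((F.P K).L : ℝ) ^ j := by
    intro q hq hqd
    have hns : ¬ box8 q ⊆ Omega Mc Rc j r j := fun hsub => hqd (Finset.mem_filter.mpr ⟨hq, hsub⟩)
    obtain ⟨z, hz, hzΩ⟩ := Set.not_subset.mp hns
    refine ⟨z, hzΩ, ?_⟩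
    have h1 := tdist_le_of_offsets (ρ := 8 * ((F.P K).L : ℤ) ^ j) hz
    rw [hd3] at h1; push_cast at h1; linarith
  -- the reach of the collar chain
  have hReach : ∀ z, z ∉ Omega Mc Rc j r j → ∃ (i : ℕ) (hi : i < j) (c : Plaq (F.P K) i), c ∈ r ⟨i, hi⟩ ∧
      ∃ x ∈ plaqCover c, (Site.tdist x z : ℝ) ≤ cR * X * ((F.P K).L : ℝ) ^ j := by
    intro z hz
    cases j with
    | zero => rw [Hist.eq_triv_zero r, Omega_triv] at hz; exact absurd (Set.mem_univ z) hz
    | succ j' =>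
      have hj'K : j' ≤ K := by omega
      obtain ⟨i, hi, c, hc, x, hx, hd⟩ := HistoryTailLaneTowerReach.exists_source_within_reach (P := F.P K) hγ hγ1' hMpos
        hR0 hr0 hj'K (by omega) Rc (fun l hl => hRcol l (by omega)) r hz
      refine ⟨i, hi, c, hc, x, hx, ?_⟩
      -- `x_{j'} = x_j + lg ≤ (1 + lg)·x_j`, `L^{j'} ≤ L^{j'+1}`, constants absorbed by `X ≥ 1`
      have hxj' : xf j' = xf (j' + 1) + lg := by
        have := hxmono j' (j' + 1) (by omega) hjK; rwa [Nat.add_sub_cancel_left, Nat.cast_one, one_mul] at this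
      have hxle : xf j' ≤ (1 + lg) * xf (j' + 1) := by
        have := le_mul_of_one_le_right hlg0.le (hx1 (j' + 1))
        rw [hxj']; linarith
      have hpow : xf j' ^ 𝔠.r₀ ≤ (1 + lg) ^ 𝔠.r₀ * X := by
        rw [hX, ← Real.mul_rpow (by linarith) (zero_le_one.trans (hx1 _))]
        exact Real.rpow_le_rpow (zero_le_one.trans (hx1 _)) hxle hr0
      have hLj : (F.L : ℝ) ^ j' ≤ (F.L : ℝ) ^ (j' + 1) := pow_le_pow_right₀ hFL1 (by omega)
      have hLj0 : (0 : ℝ) ≤ (F.L : ℝ) ^ j' := by positivity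
      have hxl : xlog (Real.sqrt (γ * (((F.P K).L : ℝ)⁻¹) ^ (K - j'))) = xf j' := by rw [hxf, hPL]
      rw [hxl, hd3, hMc', hPL] at hd
      have hd' : (Site.tdist x z : ℝ) ≤ 3 * ((𝔠.R₁ * n₀ ^ 𝔠.r₀ * (𝔠.M₁ : ℝ) * xf j' ^ 𝔠.r₀ + 𝔠.M₁ + 3 + 3 * 𝔠.M₁ * F.L) * (F.L : ℝ) ^ j') := by
        rw [hn₀]; push_cast at hd; exact hd
      have hrest : (𝔠.M₁ : ℝ) + 3 + 3 * 𝔠.M₁ * F.L ≤ ((𝔠.M₁ : ℝ) + 3 + 3 * 𝔠.M₁ * F.L) * X :=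
        le_mul_of_one_le_right (by positivity) hX1
      have hmain' : 𝔠.R₁ * n₀ ^ 𝔠.r₀ * (𝔠.M₁ : ℝ) * xf j' ^ 𝔠.r₀ + 𝔠.M₁ + 3 + 3 * 𝔠.M₁ * (F.L : ℝ) ≤ cR / 3 * X := by
        have := mul_le_mul_of_nonneg_left hpow (by positivity : (0 : ℝ) ≤ 𝔠.R₁ * n₀ ^ 𝔠.r₀ * 𝔠.M₁)
        have hexp : cR / 3 * X = 𝔠.R₁ * n₀ ^ 𝔠.r₀ * 𝔠.M₁ * ((1 + lg) ^ 𝔠.r₀ * X) + ((𝔠.M₁ : ℝ) + 3 + 3 * 𝔠.M₁ * F.L) * X := by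
          rw [hcR]; ring
        rw [hexp]; linarith
      have h0' : 0 ≤ 𝔠.R₁ * n₀ ^ 𝔠.r₀ * (𝔠.M₁ : ℝ) * xf j' ^ 𝔠.r₀ + 𝔠.M₁ + 3 + 3 * 𝔠.M₁ * (F.L : ℝ) := by
        have : 0 ≤ xf j' ^ 𝔠.r₀ := Real.rpow_nonneg (zero_le_one.trans (hx1 j')) _
        positivity
      calc (Site.tdist x z : ℝ) ≤ 3 * ((𝔠.R₁ * n₀ ^ 𝔠.r₀ * (𝔠.M₁ : ℝ) * xf j' ^ 𝔠.r₀ + 𝔠.M₁ + 3 + 3 * 𝔠.M₁ * F.L) * (F.L : ℝ) ^ j') := hd'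
        _ ≤ 3 * ((cR / 3 * X) * (F.L : ℝ) ^ (j' + 1)) := by
            refine mul_le_mul_of_nonneg_left (mul_le_mul hmain' hLj hLj0 (by positivity)) (by norm_num)
        _ = cR * X * ((F.P K).L : ℝ) ^ (j' + 1) := by rw [hPL]; ring
  -- separation margins
  have hLjpos : (0 : ℝ) < ((F.P K).L : ℝ) ^ j := by rw [hPL]; positivity
  have hρ : ∀ i, i < j → 2 * (cR * X * ((F.P K).L : ℝ) ^ j + 24 * ((F.P K).L : ℝ) ^ j + (2 + (F.P K).d) * ((F.P K).L : ℝ) ^ i) +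
      2 * (4 * ((F.P K).d * (F.P K).d) : ℕ) * ((4 + (F.P K).d) * ((F.P K).L : ℝ) ^ i) < ((F.P K).L : ℝ) ^ j * (ccol * X - 2 * (F.P K).d) := by
    intro i hi
    have hLi : ((F.P K).L : ℝ) ^ i ≤ ((F.P K).L : ℝ) ^ j := pow_le_pow_right₀ (by rw [hPL]; exact hFL1) hi.le
    have hXY : ((F.P K).L : ℝ) ^ j ≤ X * ((F.P K).L : ℝ) ^ j := le_mul_of_one_le_left hLjpos.le hX1
    rw [hd3]; push_cast
    have hexp : ((F.P K).L : ℝ) ^ j * (ccol * X - 2 * 3) =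
        2 * (cR * X * ((F.P K).L : ℝ) ^ j) + 569 * (X * ((F.P K).L : ℝ) ^ j) - 6 * ((F.P K).L : ℝ) ^ j := by rw [hccol]; ring
    rw [hexp]; linarith
  have hρd : 2 * (9 * ((F.P K).L : ℝ) ^ j) < ((F.P K).L : ℝ) ^ j * (ccol * X - 2 * (F.P K).d) := by
    have hXY : ((F.P K).L : ℝ) ^ j ≤ X * ((F.P K).L : ℝ) ^ j := le_mul_of_one_le_left hLjpos.le hX1
    rw [hd3]; push_cast
    have hexp : ((F.P K).L : ℝ) ^ j * (ccol * X - 2 * 3) =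
        2 * (cR * X * ((F.P K).L : ℝ) ^ j) + 569 * (X * ((F.P K).L : ℝ) ^ j) - 6 * ((F.P K).L : ℝ) ^ j := by rw [hccol]; ring
    have h0 : 0 ≤ cR * X * ((F.P K).L : ℝ) ^ j := mul_nonneg (mul_nonneg hcR0 (zero_le_one.trans hX1)) hLjpos.le
    rw [hexp]; linarith
  -- the Z charges: level counts and the budget
  have hc₁0 : 0 ≤ c₁ := by rw [hc₁]; positivity
  have hxr0 : ∀ i, 0 ≤ xf i ^ 𝔠.r₀ := fun i => Real.rpow_nonneg (zero_le_one.trans (hx1 i)) _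
  have hxr1 : ∀ i, 1 ≤ xf i ^ 𝔠.r₀ := fun i => Real.one_le_rpow (hx1 i) hr0
  have hLl0 : ∀ l, (0 : ℝ) ≤ ((F.P K).L : ℝ) ^ l := fun l => by positivity
  have hLl1 : ∀ l, (1 : ℝ) ≤ ((F.P K).L : ℝ) ^ l := fun l => one_le_pow₀ (by rw [hPL]; exact hFL1)
  -- the radius of the count at level `l`: `⌈c₁ x_l^{r₀} L^l⌉`
  set ρn : ℕ → ℕ := fun i => ⌈c₁ * xf i ^ 𝔠.r₀ * ((F.P K).L : ℝ) ^ i⌉₊ with hρn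
  have hρn_ge : ∀ l, 3 * ((𝔠.R₁ * (max 1 𝔠.r₀) ^ 𝔠.r₀ * Mc * xlog (Real.sqrt (γ * (((F.P K).L : ℝ)⁻¹) ^ (K - l))) ^ 𝔠.r₀ + Mc +
      (F.P K).d + (F.P K).d * Mc * (F.P K).L) * ((F.P K).L : ℝ) ^ l) + (2 + (F.P K).d) * ((F.P K).L : ℝ) ^ l ≤ (ρn l : ℝ) := by
    intro l
    refine le_trans ?_ (Nat.le_ceil _)
    have hxl : xlog (Real.sqrt (γ * (((F.P K).L : ℝ)⁻¹) ^ (K - l))) = xf l := by rw [hxf, hPL]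
    rw [hxl, hd3, hMc']; push_cast
    have e1 : ((𝔠.M₁ : ℝ) + 3 + 3 * 𝔠.M₁ * ((F.P K).L : ℝ)) ≤ ((𝔠.M₁ : ℝ) + 3 + 3 * 𝔠.M₁ * ((F.P K).L : ℝ)) * xf l ^ 𝔠.r₀ :=
      le_mul_of_one_le_right (by positivity) (hxr1 l)
    have e2 : 3 * (𝔠.R₁ * n₀ ^ 𝔠.r₀ * 𝔠.M₁ * xf l ^ 𝔠.r₀ + 𝔠.M₁ + 3 + 3 * 𝔠.M₁ * ((F.P K).L : ℝ)) + (2 + 3) ≤ c₁ * xf l ^ 𝔠.r₀ := by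
      rw [hc₁, hcw, hPL]; rw [hPL] at e1; linarith [hxr1 l, e1]
    have := mul_le_mul_of_nonneg_right e2 (hLl0 l)
    rw [hn₀] at this
    linarith [this]
  have hρn_le : ∀ l, (ρn l : ℝ) ≤ ((c₁ + 1) * xf l ^ 𝔠.r₀) * ((F.P K).L : ℝ) ^ l := by
    intro l
    have h0 : 0 ≤ c₁ * xf l ^ 𝔠.r₀ * ((F.P K).L : ℝ) ^ l := mul_nonneg (mul_nonneg hc₁0 (hxr0 l)) (hLl0 l)
    have h1 := (Nat.ceil_lt_add_one h0).le
    refine h1.trans ?_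
    have hXL : xf l ^ 𝔠.r₀ * 1 ≤ xf l ^ 𝔠.r₀ * ((F.P K).L : ℝ) ^ l := mul_le_mul_of_nonneg_left (hLl1 l) (hxr0 l)
    have hexp : (c₁ + 1) * xf l ^ 𝔠.r₀ * ((F.P K).L : ℝ) ^ l =
        c₁ * xf l ^ 𝔠.r₀ * ((F.P K).L : ℝ) ^ l + xf l ^ 𝔠.r₀ * ((F.P K).L : ℝ) ^ l := by ring
    rw [hexp]; linarith [hxr1 l]
  set cnt : ℕ → ℝ := fun i => (((2 * (2 * (F.P K).d * ρn i / (F.P K).L ^ i) + 1) ^ (F.P K).d : ℕ) : ℝ) with hcnt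
  have hcnt0 : ∀ i, 0 ≤ cnt i := fun i => Nat.cast_nonneg _
  have hZ' : (AlphaInputsT3AC.dataIntRows qf π).Zterm K j r ≤ κZ * ∑ i ∈ Finset.range j, xf i *
      ((Finset.univ.filter fun y : Site (F.P K) i => toFine i y ∉ Omega Mc Rc j r (i + 1)).card : ℝ) := by
    have h1 := (hZ K j r v hjK).2
    refine h1.trans (le_of_eq ?_)
    congr 1
    refine Finset.sum_congr rfl fun i _ => ?_
    rw [hxf_eq i, Set.ncard_eq_toFinset_card', Set.toFinset_setOf]
    rfl
  have hN : ∀ i, i < j → ((Finset.univ.filter fun y : Site (F.P K) i => toFine i y ∉ Omega Mc Rc j r (i + 1)).card : ℝ) ≤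
      (∑ l ∈ Finset.range (i + 1), ((if hl : l < j then r ⟨l, hl⟩ else (∅ : Finset (Plaq (F.P K) l))).card : ℝ)) * cnt i := by
    intro i hi
    have h1 := HistoryTailZCount.card_outside_Omega_succ_le (P := F.P K) hγ hγ1' hMpos hR0 hr0 Rc (i := i) (j := j) (K := K)
      (by omega) (by omega) (by omega) (fun l hl => hRcol l (by omega)) r (ρn i) (hρn_ge i)
    have h2 : ((Finset.univ.filter fun y : Site (F.P K) i => toFine i y ∉ Omega Mc Rc j r (i + 1)).card : ℝ) ≤
        ∑ l ∈ Finset.range (i + 1), ((if hl : l < j then r ⟨l, hl⟩ else (∅ : Finset (Plaq (F.P K) l))).card : ℝ) * cnt i := by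
      simp only [hcnt]; exact_mod_cast h1
    rw [Finset.sum_mul]; exact h2
  -- `cnt_l ≤ A·x_l^{3r₀}`
  have hcntA : ∀ l, cnt l ≤ A * xf l ^ (3 * 𝔠.r₀) := by
    intro l
    have h2 := natCnt_le (d := (F.P K).d) (l := l) (ρ := ρn l) (F.P K).L_pos (hρn_le l)
    rw [hcnt]; refine h2.trans ?_
    rw [hd3, hA]; push_cast
    have h3 : 4 * (3 : ℝ) * ((c₁ + 1) * xf l ^ 𝔠.r₀) + 1 ≤ (4 * 3 * (c₁ + 1) + 1) * xf l ^ 𝔠.r₀ := by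
      have : (4 * 3 * (c₁ + 1) + 1) * xf l ^ 𝔠.r₀ = 4 * 3 * ((c₁ + 1) * xf l ^ 𝔠.r₀) + xf l ^ 𝔠.r₀ := by ring
      rw [this]; linarith [hxr1 l]
    have h4 : (0 : ℝ) ≤ 4 * 3 * ((c₁ + 1) * xf l ^ 𝔠.r₀) + 1 := by
      have : 0 ≤ (c₁ + 1) * xf l ^ 𝔠.r₀ := mul_nonneg (by linarith) (hxr0 l)
      linarith
    calc (4 * (3 : ℝ) * ((c₁ + 1) * xf l ^ 𝔠.r₀) + 1) ^ 3 ≤ ((4 * 3 * (c₁ + 1) + 1) * xf l ^ 𝔠.r₀) ^ 3 := pow_le_pow_left₀ h4 h3 3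
      _ = (4 * 3 * (c₁ + 1) + 1) ^ 3 * xf l ^ (3 * 𝔠.r₀) := by
          rw [mul_pow, ← Real.rpow_natCast (xf l ^ 𝔠.r₀) 3, ← Real.rpow_mul (zero_le_one.trans (hx1 l))]
          push_cast; ring_nf
  -- the budget at every level
  have hxK : X₀ ≤ xf j := by
    have h1 : xf K ≤ xf j := by
      have h0 : (0 : ℝ) ≤ ((K - j : ℕ) : ℝ) * lg := mul_nonneg (Nat.cast_nonneg _) hlg0.le; rw [hxmono j K hjK le_rfl]; linarith
    have h2 : X₀ ≤ xf K := by
      have hlog : Real.log γ ≤ -(2 * (X₀ - 1)) := (Real.log_le_iff_le_exp hγ).mpr hγe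
      have hK : xf K = 1 - Real.log γ / 2 := by
        rw [hxf]; simp only [Nat.sub_self, pow_zero, mul_one, xlog]; rw [Real.log_inv, Real.log_sqrt hγ.le]; ring
      rw [hK]; linarith
    exact h2.trans h1
  have hX₀ : 515 * κZ * A / (b₀' ^ 2 * lg) ≤ xf j := (le_max_right _ _).trans hxK
  set σ : ℕ → ℝ := fun i => if i < j then cSF * 𝔠.b₀ ^ 2 / 50 * xf i ^ (2 * 𝔠.p₀ - 1) * (xf i - xf j) else 0 with hσ
  have hσ0 : ∀ i, 0 ≤ σ i := by
    intro i; rw [hσ]; simp only []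
    split_ifs with hi
    · have h1 : xf j ≤ xf i := by
        have : (0 : ℝ) ≤ ((j - i : ℕ) : ℝ) * lg := mul_nonneg (Nat.cast_nonneg _) hlg0.le
        rw [hxmono i j hi.le hjK]; linarith
      have h2 : 0 ≤ xf i ^ (2 * 𝔠.p₀ - 1) := Real.rpow_nonneg (zero_le_one.trans (hx1 i)) _
      have h3 : 0 ≤ cSF * 𝔠.b₀ ^ 2 / 50 := by have := hcSF0.le; positivity
      exact mul_nonneg (mul_nonneg h3 h2) (by linarith)
    · exact le_rfl
  have hbudget : ∀ i, i < j → ((4 * ((F.P K).d * (F.P K).d) : ℕ) : ℝ) * (σ i + κZ * ∑ l ∈ Finset.Ico i j, xf l * cnt l) ≤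
      (p i ^ 2 - p j ^ 2) / 4 := by
    intro i hi
    rw [hd3]; push_cast
    have hxij : xf i = xf j + (j - i : ℕ) * lg := hxmono i j hi.le hjK
    -- the sum of the level charges
    have hsum : ∑ l ∈ Finset.Ico i j, xf l * cnt l ≤ ((j - i : ℕ) : ℝ) * (xf i * (A * xf i ^ (3 * 𝔠.r₀))) := by
      have hterm : ∀ l ∈ Finset.Ico i j, xf l * cnt l ≤ xf i * (A * xf i ^ (3 * 𝔠.r₀)) := by
        intro l hl
        have hil : i ≤ l := (Finset.mem_Ico.mp hl).1
        have hlK : l ≤ K := by have := (Finset.mem_Ico.mp hl).2; omega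
        have hxl : xf l ≤ xf i := by
          have : (0 : ℝ) ≤ ((l - i : ℕ) : ℝ) * lg := mul_nonneg (Nat.cast_nonneg _) hlg0.le
          rw [hxmono i l hil hlK]; linarith
        have hxl0 : 0 ≤ xf l := zero_le_one.trans (hx1 l)
        calc xf l * cnt l ≤ xf l * (A * xf l ^ (3 * 𝔠.r₀)) := mul_le_mul_of_nonneg_left (hcntA l) hxl0
          _ ≤ xf i * (A * xf i ^ (3 * 𝔠.r₀)) := by
              refine mul_le_mul hxl (mul_le_mul_of_nonneg_left (Real.rpow_le_rpow hxl0 hxl (by positivity)) hA0) (by positivity)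
                (zero_le_one.trans (hx1 i))
      calc ∑ l ∈ Finset.Ico i j, xf l * cnt l ≤ ∑ _l ∈ Finset.Ico i j, xf i * (A * xf i ^ (3 * 𝔠.r₀)) := Finset.sum_le_sum hterm
        _ = ((j - i : ℕ) : ℝ) * (xf i * (A * xf i ^ (3 * 𝔠.r₀))) := by rw [Finset.sum_const, Nat.card_Ico, nsmul_eq_mul]
    have hB := budget_ineq (j - i) hb₀'pos hr1 hκZ hA0 hlg0 (μ := 36) (by norm_num) (hx1 j) hxij hX₀
    have hσi : σ i = b₀' ^ 2 / 200 * xf i ^ (2 * (2 * 𝔠.r₀ + 1) - 1) * (xf i - xf j) := by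
      rw [hσ]; simp only [hi, if_true]; rw [show 𝔠.p₀ = 2 * 𝔠.r₀ + 1 from rfl, hb₀', mul_pow, mul_pow, hsc]; ring
    rw [hσi, hp_eq i, hp_eq j]
    refine le_trans ?_ hB
    refine mul_le_mul_of_nonneg_left ?_ (by norm_num)
    have := mul_le_mul_of_nonneg_left hsum hκZ
    linarith
  -- the core
  have hd2 : 2 ≤ (F.P K).d := by rw [hd3]; norm_num
  have hcore := dilute_core hL2 hd2 Mc Rc hjm r hr T hT0 hβ0 Bl hBlcov p hSFcore S hsep Sd (Finset.filter_subset _ _) Box hBoxΩ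
    hBoxNear hBoxSF' hNonDeep hReach hρ hρd σ hσ0 hκZ xf cnt (fun i => zero_le_one.trans (hx1 i)) hcnt0 hZ' hN hbudget
  -- rewrite the large-field sets and `σ`
  have hsumeq : ∑ i ∈ Finset.range j, (((AlphaInputsT3AC.lfDataIntRows qf π).LargeP K j r i).card : ℝ) *
        (cSF * 𝔠.b₀ ^ 2 / 50 * xf i ^ (2 * 𝔠.p₀ - 1) * (xf i - xf j)) =
      ∑ i ∈ Finset.range j, ((if hi : i < j then r ⟨i, hi⟩ else (∅ : Finset (Plaq (F.P K) i))).card : ℝ) * σ i := by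
    refine Finset.sum_congr rfl fun i hi => ?_
    have hi' : i < j := Finset.mem_range.mp hi
    rw [AlphaInputsT3AC.lfDataIntRows_largeP_of_admissible qf π K j r hr i hi', hσ]
    simp only [hi', dif_pos, if_true]
  have hfinal : (S.card : ℝ) * (cSF * B10.pFun 𝔠.b₀ 𝔠.p₀ (Real.sqrt (γ * ((F.L : ℝ)⁻¹) ^ (K - j))) ^ 2) +
      ∑ i ∈ Finset.range j, (((AlphaInputsT3AC.lfDataIntRows qf π).LargeP K j r i).card : ℝ) * (cSF * 𝔠.b₀ ^ 2 / 50 * xf i ^ (2 * 𝔠.p₀ - 1) * (xf i - xf j)) ≤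
      (AlphaInputsT3AC.dataIntRows qf π).mainT K j r Wf - (AlphaInputsT3AC.dataIntRows qf π).Zterm K j r := by
    rw [← hp_sq j, hsumeq]; linarith [hcore, hmain]
  exact hfinal

end Summit.QuantumFields.YangMills.Theorems.HistoryTailDiluteExponentIntRows

end
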